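/-
Copyright (c) 2026 the pub-hodgecm-mathlib formalisation cell (harness21).  Prover seat hodgecm-mathlib-LH4-p01 (g9), (O-4) «SEAM WITNESS» pen by dealer LH4-plan (g8)
DEAL g8-#17 (re-cut, WORD #64 (ii)) on the M6 ROW-2 ★ DYADIC-TWIN road, LEAD F0P3a-plan (g15) T14-66, 2026-09-02.
-/
import Literature.NumberTheory.Rogawski1990.TypeTwoEisensteinData   -- ★ F2 p852809: `det_smul_one_add_smul_fin_two` (the norm form `det(p•1 + q•Θ)`), `exp_neg_one_pow`; the consumer `exists_eisensteinData` (its `hram`)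
import HarnessLib

/-!
# The ramified seam witness of the type-(2) Eisenstein data: `|det(α₀•1 + β₀•g)| = |ϖ|` from a skew square root of the eigen-discriminant,
# odd-order AND wild-unit rows, no `|2| = 1` (Rogawski 1990 §4.9 Prop. 4.9.1 (b); Serre, Corps locaux I §6)

Topic `NumberTheory/Rogawski1990`; namespace `Literature.NumberTheory.Rogawski1990` (★ F2's).  THEOREMS ONLY (no definition, no instance, no notation, no named fact,
no `sorry`); count-neutral; kernel lane `--supports stmt-HodgeConjecture-24833`.  Cell `pub/hodgecm-mathlib` (D-0151), crux H413 = `stmt-HodgeConjecture-24833`, M6 road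
«ROW 2 ★ DYADIC TWIN» (LEAD F0P3a-plan (g15) T14-66), dealer LH4-plan (g8) WORD #64 (ii) DEAL g8-#17 «(O-4) SEAM WITNESS»: the export that DISCHARGES ★ F2
`exists_eisensteinData`'s seam binder `hram : Valued.v (α₀ • 1 + β₀ • g).det = Valued.v ϖ` («`K[g]∕K` is ramified») from the conductor-currency frames, so that the F5
assembly does not propagate `hram` as a head hypothesis.  ★ F2 §5 `eisensteinData_of_v_two_eq_one` is the TAME witness (`Θ = ϖ^{−N}•(2g − tr g•1)`, needs `|2| = 1`);
this file gives the two `|2|`-free witnesses built from a SKEW SQUARE ROOT `y` of the discriminant, `4·det g = (tr g)² − y²·c`: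
* ODD-ORDER row (tame and wild alike; `c` a uniformiser class, ★ α1 `exists_skew_sqrt_discriminant_uniformiser` p852859 supplies `y ≠ 0`, `c = ι k₀`):
  `Θ := (−tr g∕y)•1 + (2∕y)•g` has `det Θ = −c` EXACTLY (§1), hence `|det Θ| = |c| = |ϖ|`;
* WILD-UNIT row (`c = d₀ = 1 + w_d`, `|w_d| = exp(−(2k+1))`, ★ α2 `exists_skew_sqrt_discriminant_wildUnit` (LH10-p02) supplies them):
  `Θ := ((y − tr g)∕(y·π^k))•1 + (2∕(y·π^k))•g` has `det Θ = −w_d∕π^{2k}` EXACTLY (§2), hence `|det Θ| = exp(−(2k+1))·exp(2k) = exp(−1) = |π|`.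
`2` occurs as a NUMERATOR only: no `IsUnit 2`, no `|2| = 1`, no parity-of-`d` binder (T14-66 KILL clause honoured); abstract valued field `K` exactly as ★ F2 §4, so F5 feeds
(§1) with ★ α1 §2's `⟨y, k₀, hy0, hk₀, hD, hσy, hN⟩` at `K := L_w`, `c := ι k₀` (valuation transported by ★ `valued_toPlace_of_isUnramifiedIn`) and (§2) with ★ α2's
`⟨y, d, w₀, k, hD, hσy, hdw, hw₀, h4, hN⟩` at `d₀ := ι d`, `w_d := ι w₀`, `π := ι ϖ_v` (or any uniformiser of `L_w`).
HONEST LABEL: HC_CM is proved only modulo the 7 printed citations (2 remaining named inputs: hLiu418 = stmt-HodgeConjecture-24832, h413 = stmt-HodgeConjecture-24833) until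
rung 0 closes; count-neutral (pays no organ, opens no road).

## References
* [Rogawski1990] J. D. Rogawski, *Automorphic Representations of Unitary Groups in Three Variables*, Ann. of Math. Stud. 123 (1990): §4.9 Prop. 4.9.1 (b) p. 55 (type (2):
  `K[g] = EK_w` ramified over `E_w`), Lemma 4.9.3 p. 56.
* [SerreLocalFields1979] J.-P. Serre, *Local Fields*, GTM 67 (1979): Ch. I §6 Prop. 17–18 (Eisenstein equations ∕ totally ramified extensions and their norm forms).
* [Omeara1963] O. T. O'Meara, *Introduction to Quadratic Forms*, Grundlehren 117 (1963): §63A (the dyadic unit square classes `1 + w`, `ord w` odd `< 2e`).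
-/

set_option autoImplicit false

open scoped Valued WithZero Matrix
open WithZero

namespace Literature.NumberTheory.Rogawski1990

variable {K : Type*} [Field K] [Valued K ℤᵐ⁰]

/-! ## §1 The odd-order row: `Θ = (−t∕y)•1 + (2∕y)•g`, `det Θ = −c` -/

/-- **THE SKEW-ROOT NORM VALUE** (any field): `tr g = t`, `det g = D`, `y ≠ 0`, `4D = t·t − y·y·c` ⇒ `det((−(t∕y))•1 + (2∕y)•g) = −c`
(`= (t² − 2t² + 4D)∕y²`).  [cite: SerreLocalFields1979, Ch. I §6 Prop. 17] [cite: Rogawski1990, §4.9 Lemma 4.9.3 p. 56] -/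
theorem det_smul_one_add_smul_eq_neg_of_skew_root {F : Type*} [Field F] (g : Matrix (Fin 2) (Fin 2) F) {t D y c : F}
    (htr : g.trace = t) (hdet : g.det = D) (hy : y ≠ 0) (hD : 4 * D = t * t - y * y * c) :
    ((-(t / y)) • (1 : Matrix (Fin 2) (Fin 2) F) + (2 / y) • g).det = -c := by
  rw [det_smul_one_add_smul_fin_two, htr, hdet]
  field_simp
  linear_combination hD

/-- **THE ODD-ORDER SEAM WITNESS, explicit**: in a valued field, `tr g = t`, `det g = D`, `y ≠ 0`, `4D = t·t − y·y·c`, `|c| = |ϖ|` ⇒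
`|det((−(t∕y))•1 + (2∕y)•g)| = |ϖ|` — ★ F2 `exists_eisensteinData`'s `hram` at `α₀ := −t∕y`, `β₀ := 2∕y` (no `|2| = 1`: `2` is a numerator).
[cite: Rogawski1990, §4.9 Prop. 4.9.1 (b) p. 55] [cite: SerreLocalFields1979, Ch. I §6 Prop. 17–18] -/
theorem v_det_smul_one_add_smul_eq_of_skew_root (g : Matrix (Fin 2) (Fin 2) K) {t D y c ϖ : K}
    (htr : g.trace = t) (hdet : g.det = D) (hy : y ≠ 0) (hD : 4 * D = t * t - y * y * c) (hc : Valued.v c = Valued.v ϖ) :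
    Valued.v ((-(t / y)) • (1 : Matrix (Fin 2) (Fin 2) K) + (2 / y) • g).det = Valued.v ϖ := by
  rw [det_smul_one_add_smul_eq_neg_of_skew_root g htr hdet hy hD, Valuation.map_neg, hc]

/-- **THE ODD-ORDER SEAM WITNESS** (the `∃ α₀ β₀` shape ★ F2 `exists_eisensteinData` consumes): `tr g = t`, `det g = D`, `y ≠ 0`, `4D = t·t − y·y·c`, `|c| = |ϖ|` ⇒
`∃ α₀ β₀, |det(α₀•1 + β₀•g)| = |ϖ|`.  F5 feeds it with ★ α1 §2 (`exists_skew_sqrt_discriminant_uniformiser`: `y ≠ 0`, `|k₀| = exp(−1)`, `4D = t·t − y·y·ι k₀`) at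
`c := ι k₀`.  [cite: Rogawski1990, §4.9 Prop. 4.9.1 (b) p. 55] [cite: SerreLocalFields1979, Ch. I §6 Prop. 17–18] -/
theorem exists_v_det_smul_one_add_smul_eq_of_skew_root (g : Matrix (Fin 2) (Fin 2) K) {t D y c ϖ : K}
    (htr : g.trace = t) (hdet : g.det = D) (hy : y ≠ 0) (hD : 4 * D = t * t - y * y * c) (hc : Valued.v c = Valued.v ϖ) :
    ∃ α₀ β₀ : K, Valued.v (α₀ • (1 : Matrix (Fin 2) (Fin 2) K) + β₀ • g).det = Valued.v ϖ :=
  ⟨-(t / y), 2 / y, v_det_smul_one_add_smul_eq_of_skew_root g htr hdet hy hD hc⟩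

/-! ## §2 The wild-unit row: `Θ = ((y − t)∕(y·π^k))•1 + (2∕(y·π^k))•g`, `det Θ = −w_d∕π^{2k}` -/

/-- **THE WILD-UNIT SKEW-ROOT NORM VALUE** (any field): `tr g = t`, `det g = D`, `y ≠ 0`, `π ≠ 0`, `4D = t·t − y·y·d₀`, `d₀ = 1 + w_d` ⇒
`det(((y − t)∕(y·π^k))•1 + (2∕(y·π^k))•g) = −(w_d ∕ π^{2k})` (`(y − t)² + 2t(y − t) + 4D = y² − y²·d₀ = −y²·w_d`).
[cite: Omeara1963, §63A] [cite: SerreLocalFields1979, Ch. I §6 Prop. 17] -/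
theorem det_smul_one_add_smul_eq_neg_div_of_skew_root_wildUnit {F : Type*} [Field F] (g : Matrix (Fin 2) (Fin 2) F) {t D y d₀ wd π : F}
    (htr : g.trace = t) (hdet : g.det = D) (hy : y ≠ 0) (hπ : π ≠ 0) (hD : 4 * D = t * t - y * y * d₀) (hdw : d₀ = 1 + wd) (k : ℕ) :
    (((y - t) / (y * π ^ k)) • (1 : Matrix (Fin 2) (Fin 2) F) + (2 / (y * π ^ k)) • g).det = -(wd / π ^ (2 * k)) := by
  rw [det_smul_one_add_smul_fin_two, htr, hdet]
  have hπk : π ^ k ≠ 0 := pow_ne_zero k hπ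
  rw [show π ^ (2 * k) = π ^ k * π ^ k by rw [two_mul, pow_add]]
  field_simp
  rw [hdw] at hD
  linear_combination hD

/-- **THE WILD-UNIT SEAM WITNESS, explicit**: in a valued field, `tr g = t`, `det g = D`, `y ≠ 0`, `4D = t·t − y·y·d₀`, `d₀ = 1 + w_d`, `|w_d| = exp(−(2k+1))`,
`|π| = exp(−1)` ⇒ `|det(((y − t)∕(y·π^k))•1 + (2∕(y·π^k))•g)| = |π|` (`= exp(−(2k+1))·exp(2k)`).  No `|2| = 1`: `2` is a numerator.
[cite: Rogawski1990, §4.9 Prop. 4.9.1 (b) p. 55] [cite: Omeara1963, §63A] [cite: SerreLocalFields1979, Ch. I §6 Prop. 17–18] -/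
theorem v_det_smul_one_add_smul_eq_of_skew_root_wildUnit (g : Matrix (Fin 2) (Fin 2) K) {t D y d₀ wd π : K}
    (htr : g.trace = t) (hdet : g.det = D) (hy : y ≠ 0) (hD : 4 * D = t * t - y * y * d₀) (hdw : d₀ = 1 + wd) {k : ℕ}
    (hwd : Valued.v wd = exp (-(2 * (k : ℤ) + 1))) (hπ : Valued.v π = exp (-1 : ℤ)) :
    Valued.v ((((y - t) / (y * π ^ k)) • (1 : Matrix (Fin 2) (Fin 2) K) + (2 / (y * π ^ k)) • g).det) = Valued.v π := by
  have hπ0 : π ≠ 0 := (Valuation.ne_zero_iff _).1 (by rw [hπ]; exact exp_ne_zero)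
  rw [det_smul_one_add_smul_eq_neg_div_of_skew_root_wildUnit g htr hdet hy hπ0 hD hdw k, Valuation.map_neg, map_div₀, map_pow, hwd, hπ,
    exp_neg_one_pow, ← exp_sub, exp_inj]
  push_cast
  ring

/-- **THE WILD-UNIT SEAM WITNESS** (the `∃ α₀ β₀` shape ★ F2 `exists_eisensteinData` consumes): `tr g = t`, `det g = D`, `y ≠ 0`, `4D = t·t − y·y·d₀`, `d₀ = 1 + w_d`,
`|w_d| = exp(−(2k+1))`, `|π| = exp(−1)` ⇒ `∃ α₀ β₀, |det(α₀•1 + β₀•g)| = |π|`.  F5 feeds it with ★ α2 (`exists_skew_sqrt_discriminant_wildUnit`, LH10-p02: `4D = t·t − y·y·ι d`,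
`d = 1 + w₀`, `|w₀| = exp(−(2k+1))`, `|y| = exp(−M)` ⇒ `y ≠ 0`) at `d₀ := ι d`, `w_d := ι w₀` (`map_add`∕`map_one`, valuation transported) and `π := ι ϖ_v`.
[cite: Rogawski1990, §4.9 Prop. 4.9.1 (b) p. 55] [cite: Omeara1963, §63A] [cite: SerreLocalFields1979, Ch. I §6 Prop. 17–18] -/
theorem exists_v_det_smul_one_add_smul_eq_of_skew_root_wildUnit (g : Matrix (Fin 2) (Fin 2) K) {t D y d₀ wd π : K}
    (htr : g.trace = t) (hdet : g.det = D) (hy : y ≠ 0) (hD : 4 * D = t * t - y * y * d₀) (hdw : d₀ = 1 + wd) {k : ℕ}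
    (hwd : Valued.v wd = exp (-(2 * (k : ℤ) + 1))) (hπ : Valued.v π = exp (-1 : ℤ)) :
    ∃ α₀ β₀ : K, Valued.v (α₀ • (1 : Matrix (Fin 2) (Fin 2) K) + β₀ • g).det = Valued.v π :=
  ⟨(y - t) / (y * π ^ k), 2 / (y * π ^ k), v_det_smul_one_add_smul_eq_of_skew_root_wildUnit g htr hdet hy hD hdw hwd hπ⟩

end Literature.NumberTheory.Rogawski1990
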